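import Mathlib
import Literature.Analysis.FunctionSpaces.SobolevGradCommutatorSmoothLimit
import Literature.Analysis.FunctionSpaces.SobolevGradCommutatorL1
import Literature.Analysis.FunctionSpaces.TestFunctionDensity
import Literature.Analysis.FunctionSpaces.SobolevExtensionGlue
import HarnessLib

/-!
# The DiPerna–Lions first-order commutator, IV: convergence for `θ ∈ L²` (`R_{k_i}θ + k_i ⋆ (θ div u) → 0` in `L¹`)

Analysis/FunctionSpaces support file (everything proved), sequel of `SobolevGradCommutatorSmoothLimit`
(the smooth case `θ = ψ ∈ C_c^∞`) and `SobolevGradCommutatorL1` (the uniform bound).  On a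
finite-dimensional real inner product space with an additive Haar measure `μ` invariant under negation:
for `θ ∈ L²(μ)`, `u ∈ W^{1,2}` (tree classes `MemSobolevDomain 1 2 ⊤`, `HasWeakFDerivOn ⊤ μ u Du`) and bump
kernels `k_i = (φ i).normed μ` with `rOut(φ i) → 0` whose first gradient moments `∫ ‖z‖‖∇k_i(z)‖ dz` stay
bounded (e.g. the rescaled family `bumpRescale`, for which the moment is constant,
`ContDiffBumpRescale.integral_norm_mul_norm_gradient_normed_bumpRescale`),
`∫ ‖ ∫ θ(y)⟪u(x) − u(y), ∇k_i(x−y)⟫ dy + ∫ k_i(x−y) θ(y) tr Du(y) dy ‖ dx → 0`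
(`tendsto_lintegral_gradCommutator`).  This is DiPerna–Lions 1989, Lemma II.1 (the `L¹`-convergence of the
commutator `[u·∇, k_i⋆]θ → 0`, global `L² × W^{1,2}` form), completing the tree's port of its proof:
approximate `θ` in `L²` by a test function `ψ` (`TestFunctionDensity.exists_isTestFunctionOn_eLpNorm_sub_le`),
split `θ = ψ + (θ − ψ)` (both integrals are linear in `θ`), bound the first-order remainder by the uniform
estimate `lintegral_enorm_gradCommutator_le` (`≤ K‖θ − ψ‖₂‖Du‖₂`) and the zeroth-order one by Young's
inequality (`‖k_i ⋆ ((θ−ψ) tr Du)‖₁ ≤ ‖θ−ψ‖₂‖tr Du‖₂`), and let the smooth part go to zero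
(`tendsto_lintegral_gradCommutator_smooth`).  Tools: the weak gradient of a `W^{1,p}` function is in `L^p`
(`memLp_weakFDeriv_of_memSobolevDomain`), the trace is a bounded functional (`exists_norm_trace_le_mul_norm`,
`memLp_trace_of_memLp`), integrability / measurability of the commutator integrand
(`integrable_mul_inner_sub_gradient`, `integrable_comp_sub_mul`, `aestronglyMeasurable_gradCommutator`).

[cite: DiPernaLions1989, Lemma II.1]; [cite: Evans2010, §5.2.2 (Definition of W^{k,p})]
-/

noncomputable section

open MeasureTheory Set Filter Metric Function Module ContinuousLinearMap
open scoped ENNReal NNReal InnerProductSpace Topology RealInnerProductSpace ContDiff Convolution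

namespace Literature.Analysis.FunctionSpaces

variable {H : Type*} [NormedAddCommGroup H] [InnerProductSpace ℝ H] [FiniteDimensional ℝ H]

section Trace

/-- The trace is a bounded linear functional on `H →L[ℝ] H` (finite dimension): `|tr A| ≤ C‖A‖`.
[cite: Evans2010, App. A (notation for matrices: tr A)] -/
theorem exists_norm_trace_le_mul_norm :
    ∃ C : ℝ, ∀ A : H →L[ℝ] H, ‖LinearMap.trace ℝ H (A : H →ₗ[ℝ] H)‖ ≤ C * ‖A‖ := by
  let T : (H →L[ℝ] H) →ₗ[ℝ] ℝ := (LinearMap.trace ℝ H) ∘ₗ (ContinuousLinearMap.coeLM ℝ)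
  refine ⟨‖LinearMap.toContinuousLinearMap T‖, fun A => ?_⟩
  have h := (LinearMap.toContinuousLinearMap T).le_opNorm A
  have e : LinearMap.toContinuousLinearMap T A = LinearMap.trace ℝ H (A : H →ₗ[ℝ] H) := rfl
  rwa [e] at h

end Trace

variable [MeasurableSpace H] [BorelSpace H]

section Data

variable (μ : Measure H)

/-- The weak gradient of a `W^{1,p}` function (`1 ≤ p`) lies in `L^p` (Evans, *PDE*, §5.2.2, Definition of
`W^{k,p}`: all first weak derivatives are in `L^p`; here for THE weak derivative `Du`, by a.e. uniqueness).
[cite: Evans2010, §5.2.2 (Definition of W^{k,p})] -/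
theorem memLp_weakFDeriv_of_memSobolevDomain {F : Type*} [NormedAddCommGroup F] [NormedSpace ℝ F]
    [CompleteSpace F] {p : ℝ≥0∞} (hp : 1 ≤ p) {u : H → F} {Du : H → H →L[ℝ] F}
    (hu : MemSobolevDomain 1 p (⊤ : TopologicalSpace.Opens H) μ u)
    (hDu : HasWeakFDerivOn (⊤ : TopologicalSpace.Opens H) μ u Du) : MemLp Du p μ := by
  obtain ⟨-, g, hg, hgk⟩ := hu
  have hgp : MemLp g p (μ.restrict ((⊤ : TopologicalSpace.Opens H) : Set H)) :=
    HasWeakFDerivOn.memLp_deriv hp hg hgk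
  have hae := HasWeakFDerivOn.unique_holds hg hDu
  have h := hgp.ae_eq hae
  rwa [TopologicalSpace.Opens.coe_top, Measure.restrict_univ] at h

omit [BorelSpace H] in
/-- If `Du ∈ L^p` then its trace `tr Du ∈ L^p` (the trace is a bounded functional).
[cite: Evans2010, §5.2.2 (Definition of W^{k,p})] -/
theorem memLp_trace_of_memLp {p : ℝ≥0∞} {Du : H → H →L[ℝ] H} (hDu : MemLp Du p μ) :
    MemLp (fun y => LinearMap.trace ℝ H (Du y : H →ₗ[ℝ] H)) p μ := by
  obtain ⟨C, hC⟩ := exists_norm_trace_le_mul_norm (H := H)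
  let T : (H →L[ℝ] H) →ₗ[ℝ] ℝ := (LinearMap.trace ℝ H) ∘ₗ (ContinuousLinearMap.coeLM ℝ)
  have hm : AEStronglyMeasurable (fun y => LinearMap.toContinuousLinearMap T (Du y)) μ :=
    (LinearMap.toContinuousLinearMap T).continuous.comp_aestronglyMeasurable hDu.1
  exact hDu.of_le_mul hm (Eventually.of_forall fun y => hC (Du y))

variable [μ.IsAddHaarMeasure]
variable {θ : H → ℝ} {u : H → H}

/-- Integrability of the commutator integrand `y ↦ θ(y)⟪u(x) − u(y), ∇k(x − y)⟫` for `θ, u ∈ L²` and a `C¹`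
compactly supported kernel `k` (so that the commutator is linear in `θ`). [cite: DiPernaLions1989, Lemma II.1 (proof)] -/
theorem integrable_mul_inner_sub_gradient (hθ : MemLp θ 2 μ) (hu2 : MemLp u 2 μ)
    {k : H → ℝ} (hk : ContDiff ℝ 1 k) (hkc : HasCompactSupport k) (x : H) :
    Integrable (fun y => θ y * ⟪u x - u y, gradient k (x - y)⟫) μ := by
  have hgk : Continuous (gradient k) := by
    have e : gradient k = fun y => (InnerProductSpace.toDual ℝ H).symm (fderiv ℝ k y) := rfl
    rw [e]; exact (InnerProductSpace.toDual ℝ H).symm.continuous.comp (hk.continuous_fderiv one_ne_zero)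
  have hgs : HasCompactSupport (gradient k) := by
    have e : gradient k = (InnerProductSpace.toDual ℝ H).symm ∘ fderiv ℝ k := rfl
    rw [e]; exact (hkc.fderiv (𝕜 := ℝ)).comp_left (map_zero _)
  have hgxc : Continuous fun y => gradient k (x - y) := hgk.comp (continuous_const.sub continuous_id)
  have hgxs : HasCompactSupport fun y => gradient k (x - y) := hgs.comp_homeomorph (Homeomorph.subLeft x)
  -- first term `θ y * ⟪u x, ∇k(x−y)⟫`
  have hc : Continuous fun y => ⟪u x, gradient k (x - y)⟫ := continuous_const.inner hgxc
  have hcs : HasCompactSupport fun y => ⟪u x, gradient k (x - y)⟫ :=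
    hgxs.mono fun y hy => by
      simp only [mem_support, ne_eq] at hy ⊢
      intro h; exact hy (by rw [h, inner_zero_right])
  have h1 : Integrable (fun y => ⟪u x, gradient k (x - y)⟫ • θ y) μ :=
    (hθ.locallyIntegrable one_le_two).integrable_smul_left_of_hasCompactSupport hc hcs
  -- second term `θ y * ⟪u y, ∇k(x−y)⟫ = ⟪∇k(x−y), θ y • u y⟫`
  have hθu : LocallyIntegrable (fun y => θ y • u y) μ :=
    (memLp_one_iff_integrable.1 (hu2.smul hθ)).locallyIntegrable
  have h2 : Integrable (fun y => ⟪gradient k (x - y), θ y • u y⟫) μ :=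
    integrable_inner_of_hasCompactSupport μ hgxc hgxs hθu
  have e : (fun y => θ y * ⟪u x - u y, gradient k (x - y)⟫) =
      fun y => ⟪u x, gradient k (x - y)⟫ • θ y - ⟪gradient k (x - y), θ y • u y⟫ := by
    funext y
    rw [inner_sub_left, mul_sub, real_inner_smul_right, real_inner_comm (u y), smul_eq_mul, mul_comm (θ y)]
  rw [e]
  exact h1.sub h2

omit [InnerProductSpace ℝ H] [FiniteDimensional ℝ H] [μ.IsAddHaarMeasure] in
/-- Integrability of `y ↦ k(x − y) w(y)` for `w ∈ L¹` and a continuous compactly supported kernel.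
[cite: Evans2010, App. C.4 (mollification of locally integrable functions)] -/
theorem integrable_comp_sub_mul [NormedSpace ℝ H] [IsLocallyFiniteMeasure μ] {w : H → ℝ} (hw : Integrable w μ) {k : H → ℝ} (hk : Continuous k)
    (hkc : HasCompactSupport k) (x : H) : Integrable (fun y => k (x - y) * w y) μ :=
  hw.locallyIntegrable.integrable_smul_left_of_hasCompactSupport (hk.comp (continuous_const.sub continuous_id))
    (hkc.comp_homeomorph (Homeomorph.subLeft x))

/-- The commutator `x ↦ ∫ θ(y)⟪u(x) − u(y), ∇k(x − y)⟫ dy` is a.e.-strongly measurable.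
[cite: DiPernaLions1989, Lemma II.1 (proof)] -/
theorem aestronglyMeasurable_gradCommutator (hθ : AEStronglyMeasurable θ μ) (hum : AEStronglyMeasurable u μ)
    {k : H → ℝ} (hgk : Continuous (gradient k)) :
    AEStronglyMeasurable (fun x => ∫ y, θ y * ⟪u x - u y, gradient k (x - y)⟫ ∂μ) μ := by
  have hF : AEStronglyMeasurable (Function.uncurry fun x y => θ y * ⟪u x - u y, gradient k (x - y)⟫)
      (μ.prod μ) := by
    have h1 : AEStronglyMeasurable (fun p : H × H => θ p.2) (μ.prod μ) := hθ.comp_snd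
    have h2 : AEStronglyMeasurable (fun p : H × H => u p.1) (μ.prod μ) := hum.comp_fst
    have h3 : AEStronglyMeasurable (fun p : H × H => u p.2) (μ.prod μ) := hum.comp_snd
    have h4 : AEStronglyMeasurable (fun p : H × H => gradient k (p.1 - p.2)) (μ.prod μ) :=
      (hgk.comp (continuous_fst.sub continuous_snd)).aestronglyMeasurable
    exact h1.mul ((h2.sub h3).inner h4)
  exact hF.integral_prod_right'

end Data

section Limit

variable (μ : Measure H) [μ.IsAddHaarMeasure]
variable {θ : H → ℝ} {u : H → H} {Du : H → H →L[ℝ] H}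
variable {ι : Type*} {l : Filter ι} {φ : ι → ContDiffBump (0 : H)}

/-- **DiPerna–Lions, Lemma II.1 (convergence of the commutator, global `L² × W^{1,2}` form).**
For `θ ∈ L²`, `u ∈ W^{1,2}` with weak gradient `Du`, and bump kernels `k_i = (φ i).normed μ` with
`rOut(φ i) → 0` and bounded first gradient moments `∫ ‖z‖‖∇k_i(z)‖ dz ≤ K` (eventually):
`∫ ‖ ∫ θ(y)⟪u(x) − u(y), ∇k_i(x−y)⟫ dy + ∫ k_i(x−y) θ(y) tr Du(y) dy ‖ dx → 0`, i.e.
`[u·∇, k_i⋆]θ = R_{k_i}θ + k_i ⋆ (θ div u) → 0` in `L¹`.  Proof: density of test functions in `L²`,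
the uniform bound `lintegral_enorm_gradCommutator_le`, Young's inequality, and the smooth case
`tendsto_lintegral_gradCommutator_smooth`. [cite: DiPernaLions1989, Lemma II.1] -/
theorem tendsto_lintegral_gradCommutator [μ.IsNegInvariant]
    (hθ : MemLp θ 2 μ) (hu : MemSobolevDomain 1 2 (⊤ : TopologicalSpace.Opens H) μ u)
    (hDu : HasWeakFDerivOn (⊤ : TopologicalSpace.Opens H) μ u Du)
    (hφ : Tendsto (fun i => (φ i).rOut) l (𝓝 0)) {K : ℝ}
    (hK : ∀ᶠ i in l, ∫ z, ‖z‖ * ‖gradient ((φ i).normed μ) z‖ ∂μ ≤ K) :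
    Tendsto (fun i => ∫⁻ x, ‖(∫ y, θ y * ⟪u x - u y, gradient ((φ i).normed μ) (x - y)⟫ ∂μ) +
        ∫ y, (φ i).normed μ (x - y) * θ y * LinearMap.trace ℝ H (Du y : H →ₗ[ℝ] H) ∂μ‖ₑ ∂μ) l (𝓝 0) := by
  -- data
  have hu2 : MemLp u 2 μ := by
    have h := hu.1
    rwa [TopologicalSpace.Opens.coe_top, Measure.restrict_univ] at h
  have hDu2 : MemLp Du 2 μ := memLp_weakFDeriv_of_memSobolevDomain μ one_le_two hu hDu
  set τ : H → ℝ := fun y => LinearMap.trace ℝ H (Du y : H →ₗ[ℝ] H) with hτdef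
  have hτ2 : MemLp τ 2 μ := memLp_trace_of_memLp μ hDu2
  have hG : eLpNorm (fun y => ‖Du y‖) 2 μ = eLpNorm Du 2 μ := eLpNorm_norm Du
  set A : ℝ≥0∞ := ENNReal.ofReal K * eLpNorm Du 2 μ + eLpNorm τ 2 μ with hA
  have hAtop : A ≠ ⊤ :=
    ENNReal.add_ne_top.2 ⟨ENNReal.mul_ne_top ENNReal.ofReal_ne_top hDu2.eLpNorm_ne_top, hτ2.eLpNorm_ne_top⟩
  rw [ENNReal.tendsto_nhds_zero]
  intro ε hε
  rcases eq_or_ne ε ⊤ with rfl | hεtop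
  · exact Eventually.of_forall fun _ => le_top
  have hε2 : ε / 2 ≠ 0 := (ENNReal.half_pos hε.ne').ne'
  -- choose `δ` with `δ * A ≤ ε / 2`
  set δ : ℝ≥0∞ := (ε / 2) / (A + 1) with hδ
  have hA1 : A + 1 ≠ 0 := by simp
  have hA1' : A + 1 ≠ ⊤ := ENNReal.add_ne_top.2 ⟨hAtop, ENNReal.one_ne_top⟩
  have hδ0 : δ ≠ 0 := (ENNReal.div_pos hε2 hA1').ne'
  have hδA : δ * A ≤ ε / 2 := by
    calc δ * A ≤ δ * (A + 1) := mul_le_mul_right le_self_add _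
      _ = ε / 2 := ENNReal.div_mul_cancel hA1 hA1'
  -- density: a test function `ψ` with `‖θ - ψ‖₂ ≤ δ`
  have hθr : MemLp θ 2 (μ.restrict ((⊤ : TopologicalSpace.Opens H) : Set H)) := by
    rwa [TopologicalSpace.Opens.coe_top, Measure.restrict_univ]
  obtain ⟨ψ, hψ, hθψ⟩ := exists_isTestFunctionOn_eLpNorm_sub_le (⊤ : TopologicalSpace.Opens H) (p := 2)
    (by norm_num) ENNReal.ofNat_ne_top hθr hδ0
  rw [TopologicalSpace.Opens.coe_top, Measure.restrict_univ] at hθψ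
  set η : H → ℝ := θ - ψ with hηdef
  have hψ2 : MemLp ψ 2 μ := hψ.contDiff.continuous.memLp_of_hasCompactSupport hψ.hasCompactSupport
  have hη2 : MemLp η 2 μ := hθ.sub hψ2
  have hum : AEStronglyMeasurable u μ := hu2.1
  -- the smooth part is eventually `≤ ε / 2`
  have hS := ENNReal.tendsto_nhds_zero.1 (tendsto_lintegral_gradCommutator_smooth μ hu2 hDu hψ hφ) (ε / 2)
    (pos_iff_ne_zero.2 hε2)
  filter_upwards [hS, hK] with i hSi hKi
  -- kernel data
  set k : H → ℝ := (φ i).normed μ with hk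
  have hk1 : ContDiff ℝ 1 k := (φ i).contDiff_normed
  have hkc : HasCompactSupport k := (φ i).hasCompactSupport_normed
  have hkcont : Continuous k := (φ i).continuous_normed
  have hgk : Continuous (gradient k) := by
    have e : gradient k = fun y => (InnerProductSpace.toDual ℝ H).symm (fderiv ℝ k y) := rfl
    rw [e]; exact (InnerProductSpace.toDual ℝ H).symm.continuous.comp (hk1.continuous_fderiv one_ne_zero)
  -- integrability of the zeroth-order integrands
  have hwθ : Integrable (fun y => θ y * τ y) μ := memLp_one_iff_integrable.1 (hτ2.mul' hθ)
  have hwψ : Integrable (fun y => ψ y * τ y) μ := memLp_one_iff_integrable.1 (hτ2.mul' hψ2)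
  have hwη : Integrable (fun y => η y * τ y) μ := memLp_one_iff_integrable.1 (hτ2.mul' hη2)
  -- pointwise decomposition `θ = ψ + η`
  have hC : ∀ x, (∫ y, θ y * ⟪u x - u y, gradient k (x - y)⟫ ∂μ) =
      (∫ y, ψ y * ⟪u x - u y, gradient k (x - y)⟫ ∂μ) + ∫ y, η y * ⟪u x - u y, gradient k (x - y)⟫ ∂μ := by
    intro x
    rw [← integral_add (integrable_mul_inner_sub_gradient μ hψ2 hu2 hk1 hkc x)
      (integrable_mul_inner_sub_gradient μ hη2 hu2 hk1 hkc x)]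
    refine integral_congr_ae (ae_of_all _ fun y => ?_)
    simp only [hηdef, Pi.sub_apply]
    ring
  have hM : ∀ x, (∫ y, k (x - y) * θ y * τ y ∂μ) =
      (∫ y, k (x - y) * ψ y * τ y ∂μ) + ∫ y, k (x - y) * (η y * τ y) ∂μ := by
    intro x
    have h1 : Integrable (fun y => k (x - y) * ψ y * τ y) μ := by
      have h := integrable_comp_sub_mul μ hwψ hkcont hkc x
      simpa only [mul_assoc] using h
    rw [← integral_add h1 (integrable_comp_sub_mul μ hwη hkcont hkc x)]
    refine integral_congr_ae (ae_of_all _ fun y => ?_)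
    simp only [hηdef, Pi.sub_apply]
    ring
  -- pointwise bound
  have key : ∀ a b c d : ℝ, ‖(a + b) + (c + d)‖ₑ ≤ ‖a + c‖ₑ + ‖b‖ₑ + ‖d‖ₑ := by
    intro a b c d
    calc ‖(a + b) + (c + d)‖ₑ = ‖(a + c) + (b + d)‖ₑ := by congr 1; ring
      _ ≤ ‖a + c‖ₑ + ‖b + d‖ₑ := enorm_add_le _ _
      _ ≤ ‖a + c‖ₑ + (‖b‖ₑ + ‖d‖ₑ) := add_le_add le_rfl (enorm_add_le _ _)
      _ = ‖a + c‖ₑ + ‖b‖ₑ + ‖d‖ₑ := (add_assoc _ _ _).symm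
  have hpt : ∀ x, ‖(∫ y, θ y * ⟪u x - u y, gradient k (x - y)⟫ ∂μ) + ∫ y, k (x - y) * θ y * τ y ∂μ‖ₑ ≤
      ‖(∫ y, ψ y * ⟪u x - u y, gradient k (x - y)⟫ ∂μ) + ∫ y, k (x - y) * ψ y * τ y ∂μ‖ₑ +
        ‖∫ y, η y * ⟪u x - u y, gradient k (x - y)⟫ ∂μ‖ₑ + ‖∫ y, k (x - y) * (η y * τ y) ∂μ‖ₑ := by
    intro x
    rw [hC x, hM x]
    exact key _ _ _ _
  -- measurability of the two remainder terms
  have hmC : AEStronglyMeasurable (fun x => ∫ y, η y * ⟪u x - u y, gradient k (x - y)⟫ ∂μ) μ :=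
    aestronglyMeasurable_gradCommutator μ hη2.1 hum hgk
  have heM' : ∀ x, (∫ y, k (x - y) * (η y * τ y) ∂μ) = (k ⋆[lsmul ℝ ℝ, μ] fun y => η y * τ y) x := by
    intro x
    rw [convolution_lsmul_swap]
    simp only [smul_eq_mul]
  have heM : (fun x => ∫ y, k (x - y) * (η y * τ y) ∂μ) = (k ⋆[lsmul ℝ ℝ, μ] fun y => η y * τ y) :=
    funext heM'
  have hmM : AEStronglyMeasurable (fun x => ∫ y, k (x - y) * (η y * τ y) ∂μ) μ := by
    rw [heM]
    exact (hkc.continuous_convolution_left _ hkcont hwη.locallyIntegrable).aestronglyMeasurable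
  -- the two remainder bounds
  have hB1 : ∫⁻ x, ‖∫ y, η y * ⟪u x - u y, gradient k (x - y)⟫ ∂μ‖ₑ ∂μ ≤
      ENNReal.ofReal K * δ * eLpNorm Du 2 μ := by
    refine (lintegral_enorm_gradCommutator_le μ hη2 hu hDu hk1 hkc).trans ?_
    rw [hG]
    gcongr
  have hB2 : ∫⁻ x, ‖∫ y, k (x - y) * (η y * τ y) ∂μ‖ₑ ∂μ ≤ δ * eLpNorm τ 2 μ := by
    simp_rw [heM']
    rw [← eLpNorm_one_eq_lintegral_enorm]
    refine (eLpNorm_normed_convolution_le_haar (μ := μ) (φ i) hwη.1 le_rfl).trans ?_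
    have hh := eLpNorm_smul_le_mul_eLpNorm (p := 2) (q := 2) (r := 1) (μ := μ) hτ2.1 hη2.1
    refine (le_of_eq rfl).trans (hh.trans ?_)
    gcongr
  -- assemble
  calc ∫⁻ x, ‖(∫ y, θ y * ⟪u x - u y, gradient k (x - y)⟫ ∂μ) + ∫ y, k (x - y) * θ y * τ y ∂μ‖ₑ ∂μ
      ≤ ∫⁻ x, ‖(∫ y, ψ y * ⟪u x - u y, gradient k (x - y)⟫ ∂μ) + ∫ y, k (x - y) * ψ y * τ y ∂μ‖ₑ +
          ‖∫ y, η y * ⟪u x - u y, gradient k (x - y)⟫ ∂μ‖ₑ + ‖∫ y, k (x - y) * (η y * τ y) ∂μ‖ₑ ∂μ :=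
        lintegral_mono hpt
    _ = (∫⁻ x, ‖(∫ y, ψ y * ⟪u x - u y, gradient k (x - y)⟫ ∂μ) + ∫ y, k (x - y) * ψ y * τ y ∂μ‖ₑ ∂μ) +
          (∫⁻ x, ‖∫ y, η y * ⟪u x - u y, gradient k (x - y)⟫ ∂μ‖ₑ ∂μ) +
          ∫⁻ x, ‖∫ y, k (x - y) * (η y * τ y) ∂μ‖ₑ ∂μ := by
        rw [lintegral_add_right' _ hmM.enorm, lintegral_add_right' _ hmC.enorm]
    _ ≤ ε / 2 + ENNReal.ofReal K * δ * eLpNorm Du 2 μ + δ * eLpNorm τ 2 μ :=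
        add_le_add (add_le_add hSi hB1) hB2
    _ = ε / 2 + δ * A := by rw [hA]; ring
    _ ≤ ε / 2 + ε / 2 := add_le_add le_rfl hδA
    _ = ε := ENNReal.add_halves ε

end Limit

end Literature.Analysis.FunctionSpaces

end
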